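import Summits.KontsevichZagierPeriods.KontsevichZagierPeriods.Theorems.SoloBlindZetaTwoReps
import HarnessLib

/-!
# Kontsevich–Zagier's `ζ(2) = π²/6` inside the three rules, III: the moves

Kontsevich–Zagier (*Periods*, 2001, §1.2) single out `ζ(2) = π²/6` as the test case of their
conjecture: "it is a non-trivial exercise to verify it using only the rules (1)–(3)".  Their own
solution expands `1/(1-xy)` in a geometric series and uses Calabi's trigonometric substitution, and
they leave the rule-bound verification to the reader.  Here the identity is realised *literally*
inside the calculus, for KZ's eq. (2) representation `Z = [T, 1/((1-x)y)]`, `T = {0<x<y<1}`, and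
the representation `R = [{x,y>0}, 2/(3(1+x²)(1+y²))]` of `π²/6` (a rational multiple of the square
of KZ's second representation `π = ∫ dx/(1+x²)`), by a chain of **seven moves, every one of them
with ℚ-rational data** — three additivity moves, three rational changes of variables in the plane
(`(x,y) ↦ (x²,y²)`, `(x,y) ↦ (x,y²)` and the wedge chart `(x,y) ↦ (y/x, (1+y²)/(1+x²))`), one
coordinate swap — plus the removal of a null diagonal:

* `kz_zeta_two : Equivalent zetaTwoRep piSqSixthRep`, and its pinned form `kz_zeta_two_pinned`
  for *any* two representations with these domains and integrands;
* as a by-product, a move-theoretic evaluation `zetaTwoRep_value : value Z = π²/6` that never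
  integrates in two variables (soundness of the moves + `∫₀^∞ dx/(1+x²) = π/2`);
* `kz_zetaTwoRing`: the Kontsevich–Zagier conjecture holds **unconditionally** on the subring of
  the formal period ring generated by `Z` together with all rational representations of dimension
  `≤ 1` with value in `ℚ̄ + ℚ̄π` — the first sector of the conjecture containing a genuinely
  two-dimensional, non-product period integral.

References: M. Kontsevich, D. Zagier, *Periods*, in: Mathematics Unlimited — 2001 and Beyond,
Springer 2001, §1.1–§1.2 (eq. (2) and the `ζ(2)` problem); F. Beukers, E. Calabi, J. Kolk, *Sums of
generalized harmonic series and volumes*, Nieuw Arch. Wisk. (4) 11 (1993) 217–224.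
-/

noncomputable section

namespace Summit.KontsevichZagierPeriods.KontsevichZagierPeriods.Theorems

open Set MeasureTheory
open Literature.NumberTheory.Transcendental
open Literature.NumberTheory.Transcendental.KZ

namespace SoloBlind

/-! ## Division by an integer in the formal period group modulo the moves -/

/-- `relations` is saturated with respect to multiplication by a nonzero integer: the quotient
`Q = FormalRep / relations` is a `ℚ̄`-vector space. -/
theorem mem_relations_of_nsmul_mem {c : FormalRep} {k : ℕ} (hk : k ≠ 0)
    (h : k • c ∈ relations) : c ∈ relations := by
  rw [← mkQ_eq_zero_iff] at h ⊢
  rw [map_nsmul, ← Nat.cast_smul_eq_nsmul K₀] at h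
  have hk' : ((k : ℕ) : K₀) ≠ 0 := Nat.cast_ne_zero.mpr hk
  rw [← inv_smul_smul₀ hk' (mkQ c), h, smul_zero]

/-! ## Moves on the triangle: `3[Z] ≡ 4[A]` -/

/-- Move 1 (additivity of the integrand): `[Z] - [A] - [B]` is a relation,
`1/((1-x)y) = 1/((1-x²)y) + x/((1-x²)y)`. -/
theorem zetaTwo_sub_even_sub_odd :
    of zetaTwoRep - of zetaTwoEven - of zetaTwoOdd ∈ relations := by
  refine of_sub_sub_mem_relations_of_add rfl rfl fun z hz => ?_
  change z ∈ kzTriangle at hz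
  rw [mem_kzTriangle] at hz
  simp only [zetaTwoRep, zetaTwoEven, zetaTwoOdd, ratRep_integrand]
  have h1 : z 1 ≠ 0 := (hz.1.trans hz.2.1).ne'
  have h2 : 1 - z 0 ≠ 0 := by linarith [hz.2.1, hz.2.2]
  have h3 : 1 + z 0 ≠ 0 := by linarith [hz.1]
  have h4 : 1 - z 0 ^ 2 = (1 - z 0) * (1 + z 0) := by ring
  rw [h4]
  field_simp

/-- Move 2 (the square chart `(x,y) ↦ (x²,y²)` of `T` onto itself): `[B] ≡ [T, 1/(4(1-x)y)]`,
since `x/((1-x²)y) = (1/(4(1-x²)y²))·|4xy|`. -/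
theorem equivalent_odd_quarter : Equivalent zetaTwoOdd zetaTwoQuarter := by
  obtain ⟨Φ, Φ', hΦ0, hΦ1, hsa, hderiv, hinj, himage, hdet⟩ := exists_squareChart
  refine equivalent_of_chart hsa hderiv hinj himage hdet
    (f := fun z : Fin 2 → ℝ => z 0 / ((1 - z 0 ^ 2) * z 1))
    (g := fun w : Fin 2 → ℝ => 1 / (4 * ((1 - w 0) * w 1))) (fun z hz => ?_)
    rfl (fun _ _ => rfl) rfl (fun _ _ => rfl)
  simp only [hΦ0, hΦ1]
  rw [mem_kzTriangle] at hz
  have h1 : z 1 ≠ 0 := (hz.1.trans hz.2.1).ne'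
  have h2 : 1 - z 0 ^ 2 ≠ 0 := by nlinarith [hz.1, hz.2.1, hz.2.2]
  field_simp

/-- Move 3 (additivity of the integrand, iterated): `[Z] - 4•[T, 1/(4(1-x)y)]` is a relation. -/
theorem zetaTwo_sub_four_quarter : of zetaTwoRep - 4 • of zetaTwoQuarter ∈ relations := by
  refine of_sub_nsmul_mem_relations 4 rfl fun z hz => ?_
  change z ∈ kzTriangle at hz
  rw [mem_kzTriangle] at hz
  simp only [zetaTwoRep, zetaTwoQuarter, ratRep_integrand]
  have h1 : z 1 ≠ 0 := (hz.1.trans hz.2.1).ne'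
  have h2 : 1 - z 0 ≠ 0 := by linarith [hz.2.1, hz.2.2]
  push_cast
  field_simp

/-- Moves 1–3 combined: `3[Z] - 4[A]` is a relation. -/
theorem three_zetaTwo_sub_four_even : 3 • of zetaTwoRep - 4 • of zetaTwoEven ∈ relations := by
  have h := sub_mem (add_mem (nsmul_mem zetaTwo_sub_even_sub_odd 4)
    (nsmul_mem equivalent_odd_quarter 4)) zetaTwo_sub_four_quarter
  convert h using 1
  abel

/-! ## From the triangle to the parabolic region to the wedge -/

/-- Move 4 (the half-square chart `(x,y) ↦ (x,y²)` of `T` onto `U`): `[A] ≡ [J]`,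
since `1/((1-x²)y) = (1/(2(1-x²)y²))·|2y|`. -/
theorem equivalent_even_parabolic : Equivalent zetaTwoEven parabolicRep := by
  obtain ⟨Φ, Φ', hΦ0, hΦ1, hsa, hderiv, hinj, himage, hdet⟩ := exists_halfSquareChart
  refine equivalent_of_chart hsa hderiv hinj himage hdet
    (f := fun z : Fin 2 → ℝ => 1 / ((1 - z 0 ^ 2) * z 1))
    (g := fun w : Fin 2 → ℝ => 1 / (2 * (1 - w 0 ^ 2) * w 1)) (fun z hz => ?_)
    rfl (fun _ _ => rfl) rfl (fun _ _ => rfl)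
  simp only [hΦ0, hΦ1]
  rw [mem_kzTriangle] at hz
  have h1 : z 1 ≠ 0 := (hz.1.trans hz.2.1).ne'
  have h2 : 1 - z 0 ^ 2 ≠ 0 := by nlinarith [hz.1, hz.2.1, hz.2.2]
  field_simp

/-- Move 5 (the wedge chart `(x,y) ↦ (y/x, (1+y²)/(1+x²))` of `{0<y<x}` onto `U`):
`[W, 1/((1+x²)(1+y²))] ≡ [J]`. -/
theorem equivalent_wedge_parabolic : Equivalent wedgeRep parabolicRep := by
  obtain ⟨Ψ, Ψ', hΨ0, hΨ1, hsa, hderiv, hinj, himage, hdet⟩ := exists_wedgeChart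
  refine equivalent_of_chart hsa hderiv hinj himage hdet
    (f := fun z : Fin 2 → ℝ => 1 / ((1 + z 0 ^ 2) * (1 + z 1 ^ 2)))
    (g := fun w : Fin 2 → ℝ => 1 / (2 * (1 - w 0 ^ 2) * w 1)) (fun z hz => ?_)
    rfl (fun _ _ => rfl) rfl (fun _ _ => rfl)
  simp only [hΨ0, hΨ1]
  exact wedge_pullback hz.1 hz.2

/-! ## Domain additivity on the quadrant -/

/-- Membership in the co-wedge `{0 < x < y}`, the domain of `cowedgeRep`. -/
theorem mem_cowedgeRep_domain {z : Fin 2 → ℝ} : z ∈ cowedgeRep.domain ↔ 0 < z 0 ∧ z 0 < z 1 := by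
  simp only [cowedgeRep, wedgeRep, ratRep_domain, IntegralRep.reindex_domain, mem_setOf_eq,
    mem_kzWedge, Equiv.swap_apply_left, Equiv.swap_apply_right]

/-- The integrand of `cowedgeRep` is the (symmetric) kernel. -/
theorem cowedgeRep_integrand (z : Fin 2 → ℝ) :
    cowedgeRep.integrand z = 1 / ((1 + z 0 ^ 2) * (1 + z 1 ^ 2)) := by
  simp only [cowedgeRep, wedgeRep, ratRep_integrand, IntegralRep.reindex_integrand,
    Equiv.swap_apply_left, Equiv.swap_apply_right]
  rw [mul_comm]

/-- Move 6a (additivity of the domain): `{0<y≤x} = {0<y<x} ∪ {0<y=x}`. -/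
theorem wedgeClosed_sub_wedge_sub_diag :
    of wedgeClosedRep - of wedgeRep - of diagRep ∈ relations := by
  refine domainAddRel_subset_relations ⟨2, wedgeClosedRep, wedgeRep, diagRep, ?_,
    measure_mono_null inter_subset_right volume_kzDiag, fun _ _ => rfl, fun _ _ => rfl, rfl⟩
  change kzWedgeClosed = kzWedge ∪ kzDiag
  ext z
  simp only [mem_union, mem_kzWedgeClosed, mem_kzWedge, mem_kzDiag]
  constructor
  · rintro ⟨h1, h2⟩
    rcases h2.lt_or_eq with h | h
    · exact Or.inl ⟨h1, h⟩
    · exact Or.inr ⟨h1, h⟩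
  · rintro (⟨h1, h2⟩ | ⟨h1, h2⟩)
    · exact ⟨h1, h2.le⟩
    · exact ⟨h1, h2.le⟩

/-- Move 6b (additivity of the domain): `{x,y>0} = {0<y≤x} ∪ {0<x<y}`. -/
theorem quadrant_sub_wedgeClosed_sub_cowedge :
    of quadrantRep - of wedgeClosedRep - of cowedgeRep ∈ relations := by
  refine domainAddRel_subset_relations ⟨2, quadrantRep, wedgeClosedRep, cowedgeRep, ?_,
    measure_mono_null (fun z hz => ?_) volume_kzDiag, fun _ _ => rfl,
    fun z _ => by rw [cowedgeRep_integrand]; rfl, rfl⟩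
  · ext z
    rw [mem_union, mem_cowedgeRep_domain]
    change z ∈ kzQuadrant ↔ z ∈ kzWedgeClosed ∨ _
    rw [mem_kzQuadrant, mem_kzWedgeClosed]
    constructor
    · rintro ⟨h0, h1⟩
      rcases le_or_gt (z 1) (z 0) with h | h
      · exact Or.inl ⟨h1, h⟩
      · exact Or.inr ⟨h0, h⟩
    · rintro (⟨h1, h2⟩ | ⟨h0, h2⟩)
      · exact ⟨h1.trans_le h2, h1⟩
      · exact ⟨h0, h0.trans h2⟩
  · have h1 : z 1 ≤ z 0 := (show z ∈ kzWedgeClosed from hz.1).2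
    have h2 : z 0 < z 1 := (mem_cowedgeRep_domain.mp hz.2).2
    exact absurd (h1.trans_lt h2) (lt_irrefl _)

/-- Move 7 (the coordinate swap, a linear rational change of variables):
`[{0<y<x}, k] ≡ [{0<x<y}, k]` for the symmetric kernel `k`. -/
theorem wedge_sub_cowedge : of wedgeRep - of cowedgeRep ∈ relations :=
  of_sub_of_reindex_mem_relations wedgeRep (Equiv.swap 0 1)

/-- The diagonal term is itself a relation (its domain is null). -/
theorem diag_mem_relations : of diagRep ∈ relations :=
  levelRel_le_relations (of_mem_levelRel_of_volume_eq_zero diagRep volume_kzDiag)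

/-- Moves 5–7 combined: `[{x,y>0}, k] - 2[J]` is a relation. -/
theorem quadrant_sub_two_parabolic : of quadrantRep - 2 • of parabolicRep ∈ relations := by
  have h := add_mem (sub_mem (add_mem (add_mem quadrant_sub_wedgeClosed_sub_cowedge
    wedgeClosed_sub_wedge_sub_diag) diag_mem_relations) wedge_sub_cowedge)
    (nsmul_mem equivalent_wedge_parabolic 2)
  convert h using 1
  abel

/-- `[{x,y>0}, k]` and the Fubini product `P × P` differ by a trivial move (same domain, same
integrand). -/
theorem quadrant_sub_prod : of quadrantRep - of (arctanHalfLine.prod arctanHalfLine) ∈ relations :=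
  of_sub_of_mem_relations_of_eqOn prod_arctanHalfLine_domain
    fun z _ => (prod_arctanHalfLine_integrand z).symm

/-! ## The theorem -/

/-- **`3[Z] ≡ 2[P × P]`**: three copies of Kontsevich–Zagier's `ζ(2)` representation are congruent,
modulo the moves, to two copies of the square of `P = [(0,∞), 1/(1+x²)]`. -/
theorem three_zetaTwo_sub_two_prod :
    3 • of zetaTwoRep - 2 • of (arctanHalfLine.prod arctanHalfLine) ∈ relations := by
  have h := add_mem (sub_mem (add_mem three_zetaTwo_sub_four_even
    (nsmul_mem equivalent_even_parabolic 4)) (nsmul_mem quadrant_sub_two_parabolic 2))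
    (nsmul_mem quadrant_sub_prod 2)
  convert h using 1
  abel

/-- `[{x,y>0}, 2k]`, an intermediate between `2[{x,y>0}, k]` and `3[R]`. -/
def twoKernelRep : IntegralRep 2 :=
  ratRep kzQuadrant (fun z => 2 / ((1 + z 0 ^ 2) * (1 + z 1 ^ 2))) 2
    ((1 + MvPolynomial.X 0 ^ 2) * (1 + MvPolynomial.X 1 ^ 2)) isSemialgebraic_kzQuadrant
    (fun z _ => aeval_kernel_denominator_ne_zero z) (fun z _ => by simp)
    (IntegrableOn.congr_fun (Integrable.const_mul integrableOn_kernel_quadrant 2)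
      (fun z _ => by rw [mul_one_div]) measurableSet_kzQuadrant)

/-- `3[R] - 2[{x,y>0}, k]` is a relation (two integrand-additivity moves). -/
theorem three_piSqSixth_sub_two_quadrant :
    3 • of piSqSixthRep - 2 • of quadrantRep ∈ relations := by
  have h2 : of twoKernelRep - 2 • of quadrantRep ∈ relations := by
    refine of_sub_nsmul_mem_relations 2 rfl fun z _ => ?_
    simp only [twoKernelRep, quadrantRep, ratRep_integrand]
    push_cast
    rw [mul_one_div]
  have h3 : of twoKernelRep - 3 • of piSqSixthRep ∈ relations := by
    refine of_sub_nsmul_mem_relations 3 rfl fun z _ => ?_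
    simp only [twoKernelRep, piSqSixthRep, ratRep_integrand]
    have : (0:ℝ) < (1 + z 0 ^ 2) * (1 + z 1 ^ 2) := by positivity
    push_cast
    field_simp
  have h := sub_mem h2 h3
  convert h using 1
  abel

/-- **Kontsevich–Zagier's `ζ(2) = π²/6` inside the rules.**  The representation
`Z = [{0<x<y<1}, 1/((1-x)y)]` of `ζ(2)` (*Periods*, eq. (2)) and the representation
`R = [{x,y>0}, 2/(3(1+x²)(1+y²))]` of `π²/6` are equivalent under finitely many instances of
rules (1) additivity and (2) change of variables — all with `ℚ`-rational data (rule (3) is not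
even needed). -/
theorem kz_zeta_two : Equivalent zetaTwoRep piSqSixthRep := by
  have h := sub_mem three_zetaTwo_sub_two_prod
    (add_mem three_piSqSixth_sub_two_quadrant (nsmul_mem quadrant_sub_prod 2))
  have h3 : 3 • (of zetaTwoRep - of piSqSixthRep) ∈ relations := by
    convert h using 1
    abel
  exact mem_relations_of_nsmul_mem three_ne_zero h3

/-- **Pinned form.**  Any representation with domain `{0<x<y<1}` and integrand `1/((1-x)y)` is
KZ-equivalent to any representation with domain `{x,y>0}` and integrand `2/(3(1+x²)(1+y²))`. -/
theorem kz_zeta_two_pinned (Z R : IntegralRep 2) (hZd : Z.domain = kzTriangle)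
    (hZi : EqOn Z.integrand (fun z => 1 / ((1 - z 0) * z 1)) kzTriangle)
    (hRd : R.domain = kzQuadrant)
    (hRi : EqOn R.integrand (fun z => 2 / (3 * ((1 + z 0 ^ 2) * (1 + z 1 ^ 2)))) kzQuadrant) :
    Equivalent Z R := by
  have h1 : of Z - of zetaTwoRep ∈ relations :=
    of_sub_of_mem_relations_of_eqOn hZd.symm (by rw [hZd]; exact hZi)
  have h2 : of piSqSixthRep - of R ∈ relations :=
    of_sub_of_mem_relations_of_eqOn hRd fun z hz => (hRi hz).symm
  have h := add_mem (add_mem h1 kz_zeta_two) h2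
  show of Z - of R ∈ relations
  convert h using 1
  abel

/-! ## Values, without integrating in two variables -/

/-- `value R = π²/6`, read off from `3[R] ≡ 2[P × P]` by the soundness of the moves and
`value P = π/2`. -/
theorem piSqSixthRep_value : piSqSixthRep.value = Real.pi ^ 2 / 6 := by
  have h : 3 • of piSqSixthRep - 2 • of (arctanHalfLine.prod arctanHalfLine) ∈ relations := by
    have h := add_mem three_piSqSixth_sub_two_quadrant (nsmul_mem quadrant_sub_prod 2)
    convert h using 1
    abel
  have h' := relations_le_ker_eval_holds h
  rw [AddMonoidHom.mem_ker, map_sub, map_nsmul, map_nsmul, eval_of, eval_of,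
    IntegralRep.value_prod, arctanHalfLine_value] at h'
  simp only [nsmul_eq_mul, Nat.cast_ofNat] at h'
  linear_combination h' / 3

/-- **`ζ(2) = π²/6`, move-theoretically**: the value of Kontsevich–Zagier's representation (2),
`∫∫_{0<x<y<1} dx dy/((1-x)y) = π²/6`, obtained from `kz_zeta_two` and the soundness of the moves
alone. -/
theorem zetaTwoRep_value : zetaTwoRep.value = Real.pi ^ 2 / 6 := by
  rw [← piSqSixthRep_value]
  exact Equivalent.value_eq_holds kz_zeta_two

/-! ## The `ζ(2)`-sector of the conjecture -/

/-- `P = [(0,∞), 1/(1+x²)]` is one of the rank-one generators attached to `π`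
(`value P = 0 + ½·π`). -/
theorem of_arctanHalfLine_mem_lineGens : of arctanHalfLine ∈ lineGens Real.pi :=
  ⟨1, arctanHalfLine, le_rfl, isRational_arctanHalfLine,
    ⟨0, ((1 / 2 : ℚ) : ℝ), isAlgebraic_zero, isAlgebraic_rat ℚ (1 / 2), by
      rw [arctanHalfLine_value]; push_cast; ring⟩, rfl⟩

/-- In the formal period ring modulo the moves, `3[Z] = 2[P]²`. -/
theorem three_smul_mkQ_zetaTwoRep :
    3 • mkQ (of zetaTwoRep) = 2 • (mkQ (of arctanHalfLine) * mkQ (of arctanHalfLine)) := by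
  rw [← mkQ_mul, of_mul_of, ← map_nsmul, ← map_nsmul, mkQ_eq_mkQ_iff]
  exact three_zetaTwo_sub_two_prod

/-- The class of `Z` lies in the `ℚ̄`-subalgebra generated by the class `x` of `4·[(0,1), 1/(1+t²)]`
(so `evalQ x = π`). -/
theorem mkQ_zetaTwoRep_mem_adjoin :
    mkQ (of zetaTwoRep) ∈ Algebra.adjoin K₀ {(4 : K₀) • alpha 1} := by
  have hx : (4 : K₀) • alpha 1 ∈ cellSpan :=
    Submodule.smul_mem _ _ (alpha_mem_cellSpan isAlgebraic_one one_pos)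
  have hP : mkQ (of arctanHalfLine) ∈ Algebra.adjoin K₀ {(4 : K₀) • alpha 1} :=
    mkQ_mem_adjoin_of_mem_lineGens hx (by
      rw [evalQ_four_smul_alpha_one]; exact of_arctanHalfLine_mem_lineGens)
  have h3 : (3 : K₀) • mkQ (of zetaTwoRep) =
      2 • (mkQ (of arctanHalfLine) * mkQ (of arctanHalfLine)) := by
    rw [ofNat_smul_eq_nsmul K₀]
    exact three_smul_mkQ_zetaTwoRep
  have h3' : (3 : K₀) ≠ 0 := three_ne_zero
  rw [← inv_smul_smul₀ h3' (mkQ (of zetaTwoRep)), h3]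
  exact Subalgebra.smul_mem _ (nsmul_mem (mul_mem hP hP) 2) _

/-- **The `ζ(2)`-ring**: the subring of the formal period ring generated by Kontsevich–Zagier's
`ζ(2)` representation `Z` together with all rational representations of dimension `≤ 1` whose
value lies in `ℚ̄ + ℚ̄π`. -/
def zetaTwoRing : NonUnitalSubring FormalRep :=
  NonUnitalSubring.closure (lineGens Real.pi ∪ {of zetaTwoRep})

/-- `B(π) ≤` the `ζ(2)`-ring. -/
theorem lineRing_pi_le_zetaTwoRing : lineRing Real.pi ≤ zetaTwoRing :=
  NonUnitalSubring.closure_mono subset_union_left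

/-- `[Z]` lies in the `ζ(2)`-ring. -/
theorem of_zetaTwoRep_mem_zetaTwoRing : of zetaTwoRep ∈ zetaTwoRing :=
  NonUnitalSubring.subset_closure (Or.inr rfl)

/-- **Kernel form.**  An element of the `ζ(2)`-ring with period `0` is a relation. -/
theorem zetaTwoRing_kernel {z : FormalRep} (hz : z ∈ zetaTwoRing) (h0 : eval z = 0) :
    z ∈ relations := by
  have hx : (4 : K₀) • alpha 1 ∈ cellSpan :=
    Submodule.smul_mem _ _ (alpha_mem_cellSpan isAlgebraic_one one_pos)
  refine mem_relations_of_mem_adjoin_singleton hx (mkQ_mem_of_mem_closure (fun g hg => ?_) hz) h0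
  rcases hg with hg | hg
  · exact mkQ_mem_adjoin_of_mem_lineGens hx (by rwa [evalQ_four_smul_alpha_one])
  · rw [mem_singleton_iff] at hg
    rw [hg]
    exact mkQ_zetaTwoRep_mem_adjoin

/-- **The Kontsevich–Zagier conjecture on the `ζ(2)`-ring (unconditional).**  Two integral
representations in the ring generated by `Z = [{0<x<y<1}, 1/((1-x)y)]` and the rational
representations of dimension `≤ 1` with values in `ℚ̄ + ℚ̄π` — e.g. any polynomial expressions in
`Z` and such integrals — are KZ-equivalent as soon as their periods agree. -/
theorem kz_zetaTwoRing {n m : ℕ} (r : IntegralRep n) (r' : IntegralRep m)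
    (hr : of r ∈ zetaTwoRing) (hr' : of r' ∈ zetaTwoRing) (hv : r.value = r'.value) :
    Equivalent r r' :=
  zetaTwoRing_kernel (sub_mem hr hr') (by rw [map_sub, eval_of, eval_of, hv, sub_self])

/-- In particular `Z` is KZ-equivalent to *every* representation of `π²/6` in the rank-one ring
`B(π)` — e.g. to `(2/3)·[(0,∞), 1/(1+x²)]²`, to `(8/3)·[(0,1), 1/(1+x²)]²`, … -/
theorem kz_zeta_two_of_mem_lineRing {m : ℕ} (r' : IntegralRep m)
    (hr' : of r' ∈ lineRing Real.pi) (hv : r'.value = Real.pi ^ 2 / 6) :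
    Equivalent zetaTwoRep r' :=
  kz_zetaTwoRing _ _ of_zetaTwoRep_mem_zetaTwoRing (lineRing_pi_le_zetaTwoRing hr')
    (by rw [zetaTwoRep_value, hv])

end SoloBlind

end Summit.KontsevichZagierPeriods.KontsevichZagierPeriods.Theorems
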